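import Literature.AnabelianGeometry.EtaleTheta.RealifiedDivisorMonoidsOfRlfWeak
import Literature.AnabelianGeometry.EtaleTheta.TemperedFrobenioid
import HarnessLib

/-!
# [EtTh] Def. 3.1 (ii) / Def. 3.6 (iv): base-field-theoretic divisors are non-cuspidal — the Cor. 3.8 (iii)
# input `hD1` REDUCED to a `Φ₀`-level datum, for the weak realified data `ofRlfZWeak`

Mochizuki, *The étale theta function …*, Publ. RIMS **45** (2009), Def. 3.1 (ii), PDF p.70 (printed 296)
[cite: MochizukiEtTh2009, Def 3.1 p.70] ("a meromorphic function on `Z_∞^log` that arises from `L^×`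
… will be referred to as constant"; the divisor of a constant is supported on the special fibre, i.e.
is NON-CUSPIDAL), Def. 3.3 (iii) p.73 (`Φ₀^cnst` := the image of `F₀ ≅ L^×` in `Φ₀^gp`), Def. 3.6 (i) p.76
(`ℝ·Φ₀^cnst ⊆ (Φ₀^ℝ)^gp`), Def. 3.6 (ii)(a)/(iv) pp.77–78 (`Φ^{bs-fld} := (ℝ·Φ₀^cnst)|_D ×_{(Φ^{ℝ-log})^gp} Φ`),
Cor. 3.8 (iii) p.81.

abc-iut cell, F-L2d2-1 / F-L2d2-2 repair chain (seat abc-iut-L2-d2).  The pre-step clause of Cor. 3.8 (iii)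
over the weak realified data (`cor38_iii_ofRlfZWeak_of_countable`, `Discharge/Sec3Cor38iiiOfRlfWeak.lean`)
carries, besides [FrdI] Thm. 4.2 (i), ONE tempered-Frobenioid-level datum `hD1`: "every
base-field-theoretic divisor `y ∈ Φ^{bs-fld}(A)` is non-cuspidal" (finding (D1) of gen-2 of this seat: the
typed Def. 3.3 (iii) data do not record that divisors of constants are non-cuspidal).  THIS FILE reduces
`hD1` to the `Φ₀`-LEVEL datum a geometric model supplies —
`hcn : ∀ b ∈ F₀(Y), div₀ b = [n₁]/[n₂]` with `n₁, n₂ ∈ Φ₀(Y)^ncsp` (Def. 3.1 (ii): `div` of a constant is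
`v_L(c) ·` (special fibre)) — for THE weak realified data `ofRlfZWeak dm hpf` (abc-iut-L6-t12):

* `RealifiedDivisorMonoids.ofRlfZWeak_mem_ncspR_of_mem_cnstR`: under `hcn`, an EFFECTIVE element of
  `Φ₀^ℝ(Y) = Φ₀(Y)^rlf` whose class lies in `ℝ·Φ₀^cnst` is non-cuspidal (its support consists of
  non-cuspidal primes).  Proof: for a prime `𝔮` outside the supports of the non-cuspidal elements, each
  evaluation functional `φ_{𝔮,f} : Φ₀(Y)^rlf → ℝ≥0` kills `Φ₀^ncsp`, hence (by `hcn`) `Φ₀^cnst`, and its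
  groupification is `ℝ`-LINEAR for the `ℝ`-action of `(Φ₀^rlf)^gp` (`RealAction.monGpMap_gpSMul`: `φ`
  commutes with the powers `a ↦ a^r`), so its kernel is an `ℝ`-stable subgroup containing the generators of
  `ℝ·Φ₀^cnst`; thus `φ_{𝔮,f}(x) = 0` for all `f`, i.e. `x_𝔮 = 0`;
* `TemperedFrobenioid.isNonCuspidal_of_isBaseFieldTheoreticDiv_weak`: `hD1` for EVERY tempered Frobenioid
  over `ofRlfZWeak dm hpf`, from `hcn` at the base objects.

Theorems only.  HONEST FRAMING: classical; nothing here bears on [IUTchIII] Cor. 3.12.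
-/

namespace Literature.AnabelianGeometry.EtaleTheta

open CategoryTheory Opposite Literature.AlgebraicGeometry.Frobenioids

universe u₀ v₀ u v w

namespace RealifiedDivisorMonoids

variable {D₀ : Type u₀} [Category.{v₀} D₀] (dm : DivisorMonoids.{u₀, v₀, w} D₀)
  (hpf : ∀ Y : D₀ᵒᵖ, IsPerfFactorialCof (dm.Φ₀.obj Y))

/-- **`ℝ·Φ₀^cnst ∩ Φ₀^ℝ ⊆ (Φ₀^ℝ)^ncsp` for `ofRlfZWeak`, given that divisors of constants are differences of
non-cuspidal log-divisors** (Def. 3.1 (ii) as a `Φ₀`-level datum `hcn`): an effective element of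
`Φ₀(Y)^rlf` whose class lies in the real span `ℝ·Φ₀^cnst` is supported on non-cuspidal primes.
[cite: MochizukiEtTh2009, Def 3.6 p.77] -/
theorem ofRlfZWeak_mem_ncspR_of_mem_cnstR (Y : D₀ᵒᵖ)
    (hcn : ∀ b : dm.B₀.obj Y, b ∈ dm.F₀ Y → ∃ n₁ n₂ : dm.Φ₀.obj Y, n₁ ∈ dm.ncsp₀ Y ∧ n₂ ∈ dm.ncsp₀ Y ∧
      dm.div₀ Y b * Algebra.GrothendieckGroup.of n₂ = Algebra.GrothendieckGroup.of n₁)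
    {x : (hpf Y).weak.Rlf} (hx : Algebra.GrothendieckGroup.of x ∈ (ofRlfZWeak dm hpf).cnstR Y) :
    x ∈ (ofRlfZWeak dm hpf).ncspR Y := by
  classical
  rw [mem_ofRlfZWeak_ncspR_iff]
  intro 𝔮 h𝔮
  by_contra hS
  -- every non-cuspidal `n ∈ Φ₀(Y)` has trivial `𝔮`-component in `Φ₀(Y)^rlf`
  have hn1 : ∀ n ∈ dm.ncsp₀ Y,
      ((hpf Y).weak.realification.subtype (((toRlfNatTransWeak dm.Φ₀ hpf).app Y).hom n)) 𝔮 = 1 := by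
    intro n hn
    by_contra hne
    exact hS (supp_toR_subset_toRSuppOfWeak dm hpf Y hn hne)
  -- a value functional `f` seeing `x_𝔮 ≠ 1`
  have hxq : ((x : RlfFactor (dm.Φ₀.obj Y)) 𝔮) ≠ 1 := h𝔮
  obtain ⟨f, hf⟩ : ∃ f, (((x : RlfFactor (dm.Φ₀.obj Y)) 𝔮)).toHom f ≠ 1 := by
    by_contra hall
    push Not at hall
    exact hxq (Realification.ext' fun g => by rw [hall g, Realification.toHom_one, MonoidHom.one_apply])
  -- the evaluation functional `φ = φ_{𝔮,f} : Φ₀(Y)^rlf → ℝ≥0` and its groupification `ψ`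
  let φ : (hpf Y).weak.Rlf →* Multiplicative NNReal :=
    { toFun := fun z => ((z : RlfFactor (dm.Φ₀.obj Y)) 𝔮).toHom f
      map_one' := by
        rw [OneMemClass.coe_one, Pi.one_apply, Realification.toHom_one, MonoidHom.one_apply]
      map_mul' := fun z z' => by
        rw [Submonoid.coe_mul, Pi.mul_apply, Realification.toHom_mul, MonoidHom.mul_apply] }
  have hφ_apply : ∀ z : (hpf Y).weak.Rlf, φ z = ((z : RlfFactor (dm.Φ₀.obj Y)) 𝔮).toHom f := fun _ => rfl
  -- `φ` is equivariant for the powers `a ↦ a^r` (values are multiplied by `r`)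
  let act' : NNReal → (Multiplicative NNReal →* Multiplicative NNReal) :=
    fun r => AddMonoidHom.toMultiplicative (AddMonoidHom.mulLeft r)
  have hφ_rpow : ∀ (r : NNReal) (z : (hpf Y).weak.Rlf),
      φ (IsPerfFactorialWeak.Rlf.rpow (hpf Y).weak r z) = act' r (φ z) := by
    intro r z
    apply Multiplicative.toAdd.injective
    rw [hφ_apply, IsPerfFactorialWeak.Rlf.coe_rpow, RlfFactor.rpow_apply, Realification.toAdd_toHom_rpow,
      hφ_apply]
    rfl
  -- `φ` read in `ℝ` (a group), and its extension `ψ` to the groupification `(Φ₀(Y)^rlf)^gp`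
  let castHom : Multiplicative NNReal →* Multiplicative ℝ :=
    AddMonoidHom.toMultiplicative NNReal.toRealHom.toAddMonoidHom
  have hcast_inj : Function.Injective castHom := fun a b h =>
    Multiplicative.toAdd.injective (NNReal.coe_injective (congrArg Multiplicative.toAdd h))
  let φℝ : (hpf Y).weak.Rlf →* Multiplicative ℝ := castHom.comp φ
  let ψ : Algebra.GrothendieckGroup (hpf Y).weak.Rlf →* Multiplicative ℝ := Algebra.GrothendieckGroup.lift φℝ
  have hψof : ∀ m, ψ (Algebra.GrothendieckGroup.of m) = φℝ m := fun m =>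
    DFunLike.congr_fun ((Algebra.GrothendieckGroup.lift_symm_apply (Algebra.GrothendieckGroup.lift φℝ)).symm.trans
      (Algebra.GrothendieckGroup.lift.symm_apply_apply φℝ)) m
  -- the kernel of `ψ` is stable under the `ℝ`-action of `(Φ₀(Y)^rlf)^gp` (`φ` commutes with the powers)
  have hstable : ∀ (r : ℝ) (ξ : Algebra.GrothendieckGroup (hpf Y).weak.Rlf), ψ ξ = 1 →
      ψ (IsPerfFactorialWeak.Rlf.realSMul (hpf Y).weak r ξ) = 1 := by
    intro r ξ hξ
    obtain ⟨a, b, rfl⟩ := IsPerfFactorialWeak.Rlf.gp_exists_eq_div (hpf Y).weak ξ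
    rw [map_div, hψof, hψof, div_eq_one] at hξ
    have hab : φ a = φ b := hcast_inj hξ
    have hab' : ∀ s : NNReal, φℝ (IsPerfFactorialWeak.Rlf.rpow (hpf Y).weak s a) =
        φℝ (IsPerfFactorialWeak.Rlf.rpow (hpf Y).weak s b) := fun s => by
      change castHom (φ _) = castHom (φ _)
      rw [hφ_rpow, hφ_rpow, hab]
    rw [map_div, IsPerfFactorialWeak.Rlf.realSMul_of, IsPerfFactorialWeak.Rlf.realSMul_of, map_div, map_div,
      map_div, hψof, hψof, hψof, hψof, hab', hab', div_self']
  -- `ψ ∘ ι` kills `Φ₀^cnst` (divisors of constants are quotients of non-cuspidal elements, by `hcn`)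
  have hkill : ∀ n ∈ dm.ncsp₀ Y, φℝ (((toRlfNatTransWeak dm.Φ₀ hpf).app Y).hom n) = 1 := by
    intro n hn
    change castHom (φ _) = 1
    rw [hφ_apply]
    have h1 := hn1 n hn
    rw [Submonoid.coe_subtype] at h1
    rw [h1, Realification.toHom_one, MonoidHom.one_apply, map_one]
  -- `ψ' := ψ ∘ ι : Φ₀(Y)^gp → ℝ`, `ι : Φ₀^gp → (Φ₀^rlf)^gp` the groupified natural map
  let ψ' := ψ.comp ((realDataWeak dm hpf).toRlfGp (unop Y))
  have e2 : ∀ n : dm.Φ₀.obj Y, (realDataWeak dm hpf).toRlfGp (unop Y) (Algebra.GrothendieckGroup.of n) =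
      Algebra.GrothendieckGroup.of (M := (hpf Y).weak.Rlf) (((toRlfNatTransWeak dm.Φ₀ hpf).app Y).hom n) := by
    intro n
    rw [RealificationData.toRlfGp, MonGp.map_of]
    rfl
  have hψ'of : ∀ n : dm.Φ₀.obj Y,
      ψ' (Algebra.GrothendieckGroup.of n) = φℝ (((toRlfNatTransWeak dm.Φ₀ hpf).app Y).hom n) := fun n =>
    (congrArg ψ (e2 n)).trans (hψof _)
  have hcnst : Subgroup.closure (dm.cnst Y : Set (Algebra.GrothendieckGroup (dm.Φ₀.obj Y))) ≤ ψ'.ker := by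
    rw [Subgroup.closure_le]
    rintro _ ⟨b, hb, rfl⟩
    obtain ⟨n₁, n₂, hn₁, hn₂, he⟩ := hcn b hb
    have hdiv : dm.div₀ Y b = Algebra.GrothendieckGroup.of n₁ / Algebra.GrothendieckGroup.of n₂ := by
      rw [eq_div_iff_mul_eq', he]
    rw [SetLike.mem_coe, MonoidHom.mem_ker, hdiv, map_div, hψ'of, hψ'of, hkill n₁ hn₁, hkill n₂ hn₂, div_one]
  -- `ψ` kills the real span `ℝ·Φ₀^cnst` (its kernel is an `ℝ`-stable subgroup containing the generators)
  have hker : (ofRlfZWeak dm hpf).cnstR Y ≤ ψ.ker := by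
    rw [ofRlfZWeak_cnstR]
    change Subgroup.closure _ ≤ _
    rw [Subgroup.closure_le]
    rintro _ ⟨r, c, hc, rfl⟩
    have hc1 : ψ ((realDataWeak dm hpf).toRlfGp (unop Y) c) = 1 := hcnst hc
    change ψ (IsPerfFactorialWeak.Rlf.realSMul (hpf Y).weak r ((realDataWeak dm hpf).toRlfGp (unop Y) c)) = 1
    exact hstable r _ hc1
  -- hence `φ x = 1`, contradicting the choice of `f`
  have h1 : ψ (Algebra.GrothendieckGroup.of x) = 1 := hker hx
  rw [hψof] at h1
  have h2 : φ x = 1 := hcast_inj (h1.trans (map_one castHom).symm)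
  exact hf ((hφ_apply x).symm.trans h2)

end RealifiedDivisorMonoids

namespace TemperedFrobenioid

/-- **`hD1` of `cor38_iii_ofRlfZWeak(_of_countable)` from a `Φ₀`-level datum**: for every tempered
Frobenioid over the weak realified data `ofRlfZWeak dm hpf`, if at each base object the divisors of the
constants `F₀(Y)` are quotients of non-cuspidal log-divisors (Def. 3.1 (ii)), then every
base-field-theoretic divisor `y ∈ Φ^{bs-fld}(A)` is non-cuspidal (Def. 3.6 (iv)/(v)(a)).
[cite: MochizukiEtTh2009, Def 3.6 p.78] -/
theorem isNonCuspidal_of_isBaseFieldTheoreticDiv_weak {D₀ : Type u₀} [Category.{v₀} D₀]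
    {dm : DivisorMonoids.{u₀, v₀, w} D₀} {hpf : ∀ Y : D₀ᵒᵖ, IsPerfFactorialCof (dm.Φ₀.obj Y)}
    {D : Type u} [Category.{v} D] {VD : FrdICatStub.{u, v, w} D}
    (C : TemperedFrobenioid (RealifiedDivisorMonoids.ofRlfZWeak dm hpf) D VD)
    (hcn : ∀ (A : Dᵒᵖ) (b : dm.B₀.obj (C.baseOp A)), b ∈ dm.F₀ (C.baseOp A) →
      ∃ n₁ n₂ : dm.Φ₀.obj (C.baseOp A), n₁ ∈ dm.ncsp₀ (C.baseOp A) ∧ n₂ ∈ dm.ncsp₀ (C.baseOp A) ∧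
        dm.div₀ (C.baseOp A) b * Algebra.GrothendieckGroup.of n₂ = Algebra.GrothendieckGroup.of n₁)
    (A : Dᵒᵖ) (y : C.Φ.carrier A) (hy : C.IsBaseFieldTheoreticDiv y) : C.IsNonCuspidal y :=
  RealifiedDivisorMonoids.ofRlfZWeak_mem_ncspR_of_mem_cnstR dm hpf (C.baseOp A) (hcn A) hy.2

end TemperedFrobenioid

end Literature.AnabelianGeometry.EtaleTheta
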